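import Summits.QuantumFields.BalabanUV.T4Continuum.Support.NE7EtaBackgroundCloseness
import Summits.QuantumFields.BalabanUV.T4Continuum.Support.NE7EtaPlainGradientHolder
import HarnessLib

/-!
# NE7EtaBackgroundClosenessHolder — route #1 of the NE7 crux (node U5), socket `h` AMENDMENT 5 (ROAD-G106 §4): NODE O's closeness binder
# `hclose` (`NE7EtaBackgroundCloseness.hclose_of_covRoot` ∕ `_occ`, gen 25) RE-DERIVED FROM THE AMENDED SOCKET `h′` = (E) + (Lip₁ᶜ) + (Höl½ᶜ)
# (transported Hölder-½ drift of the covariant gradient along lines, [Balaban1985RegularSpaces] Thm 2 (1.36) SHAPE) in place of (Lip₂′ᶜ);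
# rate base `θ^{18} = L⁻¹` (the smooth-gauge letter of `hexB` accordingly reads `σ_B·θ^{18(K+1)}` = `σ_B·η`)

Cell `pub-balaban`, rung (B)+1 sub-cell t4, lineage `b2b-balaban-t4-ne7-p1`, generation 106 (CRUX PROVER NE7 #1 = OWNER of BINDER row NE7).
Memo `t4/b2b-balaban-t4-ne7-p1-g106/ROAD-G106.md` §4.
WHAT ([folklore]; 0 def, 0 sorry).  **`hclose_of_covRootH`**, **`hclose_of_covRootH_occ`**: the statements of gen 25's `hclose_of_covRoot` ∕ `hclose_of_covRoot_occ`
VERBATIM except: `hθ18 : θ^{18} = L⁻¹` replaces `hθ6`; the socket `h` is the amended `h′` (its last conjunct is (Höl½ᶜ) with constant `Λ_H ≥ 0` in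
place of (Lip₂′ᶜ) with `Λ₂′ > 0`); the smooth-gauge letter of `hexB` reads `‖A_B‖ ≤ σ_B·θ^{18(K+1)}`.  Conclusion unchanged: selections that are gauge
copies of a minimiser pair for the datum itself above a v-free threshold, the trivial background below, and `C.gauge (uA K v) (C.transport (uB K v)) ≤ C₃·θ^K`.
Proof = gen 25's, with the thresholds taken at `θ³`, `θ^{12}`, `θ⁹`, the END `NE7EtaPlainGradientHolder.plain_closeness_of_covRootH_oneLetter` and
`plainReading_le_rate_H`; `C₃ ≥ 16l₁²γ + (16l₁²γ + √2Λ_H) + 960l₁²γσ_B + 128l₁⁴γ²` up to the prefix.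
HONEST FRAMING (page 1): bookkeeping ([folklore]); `h′`, hexA, hexB are HYPOTHESES (hexB = LOCAL printed-TYPE + UNPRINTED torus globalisation under
`hsector`, as in gen 25); nothing of NE3∕NE7 discharged; the END re-threading above `hclose` is NOT in this file; nothing of Bałaban's asserted as
an axiom; spine count = dagwriter∕referees' call; FIXED FINITE T⁴, rung (B)+1 — NOT infinite volume, NOT mass gap, NOT BetaPertH, NOT Clay.
-/

set_option autoImplicit false

open scoped BigOperators Matrix Matrix.Norms.L2Operator
open Finset NormedSpace

namespace Summit.QuantumFields.BalabanUV.T4Continuum.NE7EtaBackgroundClosenessHolder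

open Literature.MathematicalPhysics.QuantumFieldTheory.Balaban1983to89
open B7Prop1Explicit B7Prop2Explicit
open T4AveragingDeficitWall hiding Site Plane Plaq Bond
open T4AveragingDeficitWallBoundary (periodBox IsPeriodicCfg)
open T4OutputRate (Carriers)
open AveragingDeficitPeriodicCounting (IsPeriodicDir)
open AveragingDeficitMultiLevelPrep (LevelSmall)
open MinimalActionSandwich (IsMinimiser)
open MinimalActionRate (Regular sfClass)
open NE3EnergyShapes (residualScale IsUnitarySite IsPeriodicSite)
open NE3EnergyWeightedShapes (energyNormW)
open AveragingDeficitDualResidual (dualC1 dualC2)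
open AveragingDeficitDerivWallProof (wallConst)
open NE7EtaBackgroundCarrier

noncomputable section

variable {n : Type} [Fintype n] [DecidableEq n] [Nonempty n]

/-! ## §1 The closeness binder on `bgCarriers` (abstract classes) -/

/-- **THE CLOSENESS BINDER `hclose` OF `uRateUpTo_tower` ON THE BACKGROUND-COORDINATE CARRIER, CONDITIONAL ON THE AMENDED SOCKET `h′`** (module
docstring; hypotheses `h` = the amended socket (E) + (Lip₁ᶜ) + (Höl½ᶜ) (AMENDMENT 5), `hexA`, `hexB` displayed with `hsector` — LOCAL printed-TYPE ([Balaban1985Variational] Thm 1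
(9) p. 279) + UNPRINTED torus globalisation, `σ_B = σ_B(N)`, asserted nowhere —, `hdom`, K-free `LevelSmall`, the carrier's class binders;
conclusion (a) the selections are gauge copies of a minimiser pair for the datum itself from the v-free threshold `K₀` on, (b) the trivial
background below it, (c) `∀ K, ∀ v ∈ dom, C.gauge (uA K v) (C.transport (uB K v)) ≤ C₃·θ^K`). [folklore] -/
theorem hclose_of_covRootH {L N : ℕ} (hL : 2 ≤ L) (hN : 1 ≤ N) {θ : ℝ} (hθ : 0 < θ)
    (hθ18 : θ ^ 18 = ((L : ℝ))⁻¹) {ε : ℝ} (hε : 0 ≤ ε) (hls : ∀ j : ℕ, LevelSmall 4 L j (ε / ((L : ℝ) ^ (j + 1)) ^ 2))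
    {b g C Λ₁ ΛH : ℝ} (hb : 0 ≤ b) (hbs : 512 * (4 + 1) * (4 + 4) * (L : ℝ) ^ 2 * b ≤ 1) (hg : 0 ≤ g) (hC : 0 ≤ C)
    (hΛH : 0 ≤ ΛH) {dom : Set (Site 4 → Fin 4 → (Matrix n n ℂ)ˣ)}
    (hdom : ∀ v ∈ dom, ∀ w : Site 4 → (Matrix n n ℂ)ˣ, IsUnitarySite w → IsPeriodicSite w (N : ℤ) → gaugeAct w v ∈ dom)
    (h : ∀ k : ℕ, 1 ≤ k → ∀ V ∈ dom, ∀ UA UB : Site 4 → Fin 4 → (Matrix n n ℂ)ˣ,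
      IsMinimiser 4 (sfClass 4 L N ε) L N k V UA → IsMinimiser 4 (sfClass 4 L N ε) L N (k + 1) V UB →
        Regular 4 L N b g (k + 1) UB →
        ∃ (u : Site 4 → (Matrix n n ℂ)ˣ) (Z : Site 4 → Fin 4 → Matrix n n ℂ),
          IsUnitarySite u ∧ IsPeriodicSite u ((N * L ^ k : ℕ) : ℤ) ∧
          IsSkewDir Z ∧ IsPeriodicDir Z ((N * L ^ k : ℕ) : ℤ) ∧
          gaugeAct u UA = vary (rescale L (bavg L UB)) Z 1 ∧
          energyNormW L k (rescale L (bavg L UB)) Z (periodBox (N * L ^ k)) ≤ C * residualScale 4 L N b g k ∧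
          (∀ (κ : Fin 4) (x : Site 4) (μ : Fin 4),
            ‖Ad (rescale L (bavg L UB) (x + e κ) μ) (Z (x + e μ) κ) - Z x κ‖ ≤ Λ₁ * (((L : ℝ)⁻¹) ^ k) ^ 2) ∧
          (∀ (κ μ : Fin 4) (y : Site 4) (j : ℕ),
            ‖Ad (((List.range j).map fun i : ℕ => rescale L (bavg L UB) (y + e κ + i • e μ) μ).prod)
                  (Ad (rescale L (bavg L UB) (y + j • e μ + e κ) μ) (Z (y + j • e μ + e μ) κ) - Z (y + j • e μ) κ)
                - (Ad (rescale L (bavg L UB) (y + e κ) μ) (Z (y + e μ) κ) - Z y κ)‖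
              ≤ ΛH * Real.sqrt (j : ℝ) * (((L : ℝ)⁻¹) ^ k) ^ 2 * Real.sqrt (((L : ℝ)⁻¹) ^ k)))
    {γ l₁ : ℝ} (hγ : 0 < γ)
    (hγ3 : C * (wallConst 4 L * (N : ℝ) ^ 2 * (Real.sqrt g * dualC2 4 L + 2 * b ^ 2 * dualC1 4 L)) ≤ γ ^ 3)
    (hl₁ : 0 < l₁) (hΛl₁ : Λ₁ ≤ l₁ ^ 3)
    (hexA : ∀ K : ℕ, 1 ≤ K → ∀ v ∈ dom, ∃ UA : Site 4 → Fin 4 → (Matrix n n ℂ)ˣ, IsMinimiser 4 (sfClass 4 L N ε) L N K v UA)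
    {σB c₀ : ℝ} (hσB : 0 ≤ σB) (hsector : (Fintype.card n : ℝ) * (N : ℝ) ^ 2 * ε ≤ c₀)
    (hexB : ∀ K : ℕ, 1 ≤ K → ∀ v ∈ dom, (Fintype.card n : ℝ) * (N : ℝ) ^ 2 * ε ≤ c₀ →
      ∃ UB : Site 4 → Fin 4 → (Matrix n n ℂ)ˣ, IsMinimiser 4 (sfClass 4 L N ε) L N (K + 1) v UB ∧ Regular 4 L N b g (K + 1) UB ∧
        ∃ uB : Site 4 → (Matrix n n ℂ)ˣ, IsUnitarySite uB ∧ IsPeriodicSite uB ((N * L ^ (K + 1) : ℕ) : ℤ) ∧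
          ∃ AB : Site 4 → Fin 4 → Matrix n n ℂ, ∀ (x : Site 4) (κ : Fin 4),
            ((gaugeAct uB UB x κ : (Matrix n n ℂ)ˣ) : Matrix n n ℂ) = exp (AB x κ) ∧ ‖AB x κ‖ ≤ σB * θ ^ (18 * (K + 1)))
    (D : Type) (sc : D → ℕ) (dl : D → ℝ) (hdl : ∀ X, 0 ≤ dl X) {admA admB : ℕ → Set (Site 4 → Fin 4 → (Matrix n n ℂ)ˣ)}
    (hmaps : ∀ (k : ℕ) (U : Site 4 → Fin 4 → (Matrix n n ℂ)ˣ), U ∈ admB k → rescale L (bavg L U) ∈ admA k)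
    (h1A : ∀ k, (1 : Site 4 → Fin 4 → (Matrix n n ℂ)ˣ) ∈ admA k) (h1B : ∀ k, (1 : Site 4 → Fin 4 → (Matrix n n ℂ)ˣ) ∈ admB k)
    (hadmA : ∀ K : ℕ, ∀ V ∈ dom, ∀ U : Site 4 → Fin 4 → (Matrix n n ℂ)ˣ, IsMinimiser 4 (sfClass 4 L N ε) L N K V U → U ∈ admA K)
    (hadmB : ∀ K : ℕ, ∀ V ∈ dom, ∀ U : Site 4 → Fin 4 → (Matrix n n ℂ)ˣ,
      IsMinimiser 4 (sfClass 4 L N ε) L N (K + 1) V U → U ∈ admB K) :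
    ∃ (uA : ℕ → (Site 4 → Fin 4 → (Matrix n n ℂ)ˣ) → (bgCarriers n L N D sc dl hdl admA admB hmaps).BgA)
      (uB : ℕ → (Site 4 → Fin 4 → (Matrix n n ℂ)ˣ) → (bgCarriers n L N D sc dl hdl admA admB hmaps).BgB) (K₀ : ℕ) (C₃ : ℝ),
      0 ≤ C₃ ∧
      (∀ K : ℕ, K₀ ≤ K → ∀ v ∈ dom, ∃ (UA UB : Site 4 → Fin 4 → (Matrix n n ℂ)ˣ) (wA wB : Site 4 → (Matrix n n ℂ)ˣ),
        IsMinimiser 4 (sfClass 4 L N ε) L N K v UA ∧ IsMinimiser 4 (sfClass 4 L N ε) L N (K + 1) v UB ∧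
        Regular 4 L N b g (K + 1) UB ∧ IsUnitarySite wA ∧ IsPeriodicSite wA ((N * L ^ K : ℕ) : ℤ) ∧
        IsUnitarySite wB ∧ IsPeriodicSite wB ((N * L ^ (K + 1) : ℕ) : ℤ) ∧
        (uA K v).1 = (K, gaugeAct wA UA) ∧ (uB K v).1 = (K, gaugeAct wB UB)) ∧
      (∀ (K : ℕ) (v : Site 4 → Fin 4 → (Matrix n n ℂ)ˣ), ¬ (K₀ ≤ K ∧ v ∈ dom) →
        (uA K v).1 = (K, 1) ∧ (uB K v).1 = (K, 1)) ∧
      ∀ K : ℕ, ∀ v ∈ dom, (bgCarriers n L N D sc dl hdl admA admB hmaps).gauge (uA K v)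
          ((bgCarriers n L N D sc dl hdl admA admB hmaps).transport (uB K v))
        ≤ C₃ * θ ^ K := by
  classical
  have hL1 : 1 ≤ L := by omega
  have hL0 : (0 : ℝ) < L := by exact_mod_cast (by omega : 0 < L)
  have hθ1 : θ < 1 := by
    have h3 : θ ^ 3 < 1 := theta_lt_one hL (pow_pos hθ 3) (NE7EtaRatesD4Holder.cube_pow_six hθ18)
    by_contra hc
    push Not at hc
    exact absurd h3 (not_lt.mpr (one_le_pow₀ hc))
  have hθ1' : θ ≤ 1 := hθ1.le
  have hb1 : b < 1 := by
    have hL1r : (1 : ℝ) ≤ (L : ℝ) ^ 2 := one_le_pow₀ (by exact_mod_cast hL1)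
    nlinarith
  have hNr : (0 : ℝ) < N := by exact_mod_cast (by omega : 0 < N)
  -- thresholds
  obtain ⟨k₁, hk₁⟩ := NE7EtaRatesD4.exists_fit_threshold (θ := θ ^ 3) (by positivity)
    (pow_lt_one₀ hθ.le hθ1 (by norm_num)) γ (B := l₁ * N) (by positivity)
  obtain ⟨k₂, hk₂⟩ := NE7EtaRatesD4.exists_fit_threshold (θ := θ ^ 12) (by positivity)
    (pow_lt_one₀ hθ.le hθ1 (by norm_num)) (8 * l₁ ^ 2 * γ) (B := 1) one_pos
  obtain ⟨k₃, hk₃⟩ := NE7EtaRatesD4.exists_fit_threshold (θ := θ ^ 9) (by positivity)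
    (pow_lt_one₀ hθ.le hθ1 (by norm_num)) (10 * (L : ℝ) * σB) (B := 1 / 64) (by norm_num)
  set K₀ : ℕ := max (max 1 k₁) (max k₂ k₃) with hK₀
  -- total selection functions from hexA / hexB
  have hexA' : ∀ (K : ℕ) (v : Site 4 → Fin 4 → (Matrix n n ℂ)ˣ), ∃ UA : Site 4 → Fin 4 → (Matrix n n ℂ)ˣ,
      1 ≤ K → v ∈ dom → IsMinimiser 4 (sfClass 4 L N ε) L N K v UA := by
    intro K v
    by_cases hk : 1 ≤ K ∧ v ∈ dom
    · obtain ⟨UA, hUA⟩ := hexA K hk.1 v hk.2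
      exact ⟨UA, fun _ _ => hUA⟩
    · exact ⟨1, fun h1 h2 => (hk ⟨h1, h2⟩).elim⟩
  choose fA hfA using hexA'
  have hexB' : ∀ (K : ℕ) (v : Site 4 → Fin 4 → (Matrix n n ℂ)ˣ), ∃ (UB : Site 4 → Fin 4 → (Matrix n n ℂ)ˣ)
      (uB : Site 4 → (Matrix n n ℂ)ˣ) (AB : Site 4 → Fin 4 → Matrix n n ℂ), 1 ≤ K → v ∈ dom →
        IsMinimiser 4 (sfClass 4 L N ε) L N (K + 1) v UB ∧ Regular 4 L N b g (K + 1) UB ∧ IsUnitarySite uB ∧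
        IsPeriodicSite uB ((N * L ^ (K + 1) : ℕ) : ℤ) ∧
        ∀ (x : Site 4) (κ : Fin 4), ((gaugeAct uB UB x κ : (Matrix n n ℂ)ˣ) : Matrix n n ℂ) = exp (AB x κ) ∧
          ‖AB x κ‖ ≤ σB * θ ^ (18 * (K + 1)) := by
    intro K v
    by_cases hk : 1 ≤ K ∧ v ∈ dom
    · obtain ⟨UB, hUB, hreg, uB, hu, huP, AB, hAB⟩ := hexB K hk.1 v hk.2 hsector
      exact ⟨UB, uB, AB, fun _ _ => ⟨hUB, hreg, hu, huP, hAB⟩⟩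
    · exact ⟨1, 1, 0, fun h1 h2 => (hk ⟨h1, h2⟩).elim⟩
  choose fB fuB fAB hfB using hexB'
  -- the constant
  set CO : ℝ := 16 * l₁ ^ 2 * γ + ((16 * l₁ ^ 2 * γ + Real.sqrt 2 * ΛH) + 16 * l₁ ^ 2 * γ * (60 * σB) + 128 * l₁ ^ 4 * γ ^ 2)
    with hCO
  -- the root applied to the re-gauged pair above the threshold
  have hsel : ∀ (K : ℕ) (v : Site 4 → Fin 4 → (Matrix n n ℂ)ˣ), ∃ u : Site 4 → (Matrix n n ℂ)ˣ, K₀ ≤ K → v ∈ dom →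
      IsUnitarySite u ∧ IsPeriodicSite u ((N * L ^ K : ℕ) : ℤ) ∧
      gaugeAct u (gaugeAct (fun x : Site 4 => fuB K v ((L : ℤ) • x)) (fA K v)) ∈ admA K ∧
      gaugeAct (fuB K v) (fB K v) ∈ admB K ∧
      plainReading L N K (gaugeAct u (gaugeAct (fun x : Site 4 => fuB K v ((L : ℤ) • x)) (fA K v)))
        (rescale L (bavg L (gaugeAct (fuB K v) (fB K v)))) ≤ CO * θ ^ K := by
    intro K v
    by_cases hKv : K₀ ≤ K ∧ v ∈ dom
    · obtain ⟨hK, hv⟩ := hKv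
      have hK1 : 1 ≤ K := le_trans (le_trans (le_max_left 1 k₁) (le_max_left _ _)) hK
      have hKk₁ : k₁ ≤ K := le_trans (le_trans (le_max_right 1 k₁) (le_max_left _ _)) hK
      have hKk₂ : k₂ ≤ K := le_trans (le_trans (le_max_left k₂ k₃) (le_max_right _ _)) hK
      have hKk₃ : k₃ ≤ K := le_trans (le_trans (le_max_right k₂ k₃) (le_max_right _ _)) hK
      obtain ⟨j, rfl⟩ : ∃ j, K = j + 1 := ⟨K - 1, by omega⟩
      have hA0 := hfA (j + 1) v hK1 hv
      obtain ⟨hB0, hreg0, hwu, hwp, hAB⟩ := hfB (j + 1) v hK1 hv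
      -- the re-gauged triple and the moved datum
      obtain ⟨hA', hB', hreg'⟩ :=
        NE7EtaRegularGaugeInvariance.covRoot_hypotheses_gaugeAct hL1 hε j (hls j) (hls (j + 1)) hb1 hA0 hB0 hreg0 hwu hwp
      have hV' : gaugeAct (fun w : Site 4 => fuB (j + 1) v (((L : ℤ) ^ (j + 2)) • w)) v ∈ dom :=
        hdom v hv _ (NE7EtaMinimiserGaugeCovariance.isUnitarySite_corner hwu _) (isPeriodicSite_corner hwp)
      -- the smallness lines at this level
      have hfit : γ * ((θ ^ 3) ^ (j + 1)) ^ 2 ≤ l₁ * N := hk₁ (j + 1) hKk₁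
      have hp1 : 8 * l₁ ^ 2 * γ * θ ^ (24 * (j + 1)) ≤ 1 := by
        have h2 := hk₂ (j + 1) hKk₂
        have e : ((θ ^ 12) ^ (j + 1)) ^ 2 = θ ^ (24 * (j + 1)) := by rw [← pow_mul, ← pow_mul]; congr 1; ring
        rw [e] at h2
        exact h2
      have hsmooth : 10 * (L : ℝ) * (σB * θ ^ (18 * (j + 1 + 1))) ≤ 1 / 64 := by
        have h3 := hk₃ (j + 1 + 1) (by omega)
        have e : ((θ ^ 9) ^ (j + 1 + 1)) ^ 2 = θ ^ (18 * (j + 1 + 1)) := by rw [← pow_mul, ← pow_mul]; congr 1; ring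
        rw [e] at h3
        linarith
      obtain ⟨u, Z, hu, huP, -, -, -, hi, hii⟩ :=
        NE7EtaPlainGradientHolder.plain_closeness_of_covRootH_oneLetter (𝒞 := sfClass 4 L N ε) hL hN hθ hθ1' hθ18 hb hbs
          hg hC hΛH h hγ hγ3 hl₁ hΛl₁ hK1 hfit hp1 hV' hA' hB' hreg' hσB hAB hsmooth
      refine ⟨u, fun _ _ => ⟨hu, huP, ?_, ?_, ?_⟩⟩
      · -- the run-A selection is a minimiser for a datum of `dom`
        have hmin := NE7EtaMinimiserGaugeCovariance.isMinimiser_gaugeAct hL1 hε j (hls j) hA' hu huP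
        exact hadmA (j + 1) _ (hdom _ hV' _ (NE7EtaMinimiserGaugeCovariance.isUnitarySite_corner hu _)
          (isPeriodicSite_corner huP)) _ hmin
      · exact hadmB (j + 1) _ hV' _ hB'
      · have hA16 : 0 ≤ 16 * l₁ ^ 2 * γ := by positivity
        have hCG : 0 ≤ (16 * l₁ ^ 2 * γ + Real.sqrt 2 * ΛH) + 16 * l₁ ^ 2 * γ * (60 * σB) + 128 * l₁ ^ 4 * γ ^ 2 := by
          positivity
        exact NE7EtaPlainGradientHolder.plainReading_le_rate_H hθ hθ1' hθ18 hA16 hCG hi hii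
    · exact ⟨1, fun h1 h2 => (hKv ⟨h1, h2⟩).elim⟩
  choose fu hfu using hsel
  -- the geometric majorant over all cutoffs (the finitely many below `K₀` read the trivial background)
  set δ : ℕ → ℝ := fun K => if K₀ ≤ K then CO * θ ^ K
    else levelGauge L N (K, (1 : Site 4 → Fin 4 → (Matrix n n ℂ)ˣ)) (K, rescale L (bavg L (1 : Site 4 → Fin 4 → (Matrix n n ℂ)ˣ)))
    with hδ
  have hδK : ∀ K, K₀ ≤ K → δ K ≤ CO * θ ^ K := fun K hK => by simp only [hδ, if_pos hK, le_rfl]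
  obtain ⟨C₃, hC₃, hmaj⟩ := NE7EtaRatesD4.exists_geometric_majorant hθ hδK
  -- the selections
  refine ⟨fun K v => if hKv : K₀ ≤ K ∧ v ∈ dom then
      ⟨(K, gaugeAct (fu K v) (gaugeAct (fun x : Site 4 => fuB K v ((L : ℤ) • x)) (fA K v))), (hfu K v hKv.1 hKv.2).2.2.1⟩
      else ⟨(K, 1), h1A K⟩,
    fun K v => if hKv : K₀ ≤ K ∧ v ∈ dom then ⟨(K, gaugeAct (fuB K v) (fB K v)), (hfu K v hKv.1 hKv.2).2.2.2.1⟩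
      else ⟨(K, 1), h1B K⟩, K₀, C₃, hC₃, ?_, ?_, ?_⟩
  · -- the selections are gauge copies of a minimiser pair for the datum itself
    intro K hK v hv
    have hKv : K₀ ≤ K ∧ v ∈ dom := ⟨hK, hv⟩
    have hK1 : 1 ≤ K := le_trans (le_trans (le_max_left 1 k₁) (le_max_left _ _)) hK
    obtain ⟨hB0, hreg0, hwu, hwp, -⟩ := hfB K v hK1 hv
    obtain ⟨hu, huP, -, -, -⟩ := hfu K v hK hv
    obtain ⟨j, rfl⟩ : ∃ j, K = j + 1 := ⟨K - 1, by omega⟩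
    refine ⟨fA (j + 1) v, fB (j + 1) v, fu (j + 1) v * fun x : Site 4 => fuB (j + 1) v ((L : ℤ) • x), fuB (j + 1) v,
      hfA (j + 1) v hK1 hv, hB0, hreg0,
      isUnitarySite_mul hu (NE7EtaSmoothGaugeTransport.isUnitarySite_rescaleGauge L hwu),
      isPeriodicSite_mul huP (NE7EtaSmoothGaugeTransport.isPeriodicSite_rescaleGauge hwp), hwu, hwp, ?_, ?_⟩
    · simp only [dif_pos hKv, gaugeAct_mul']
    · simp only [dif_pos hKv]
  · intro K v hKv
    simp only [dif_neg hKv, and_self]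
  · intro K v hv
    rw [bgCarriers_gauge, bgCarriers_transport_val]
    by_cases hK : K₀ ≤ K
    · have hKv : K₀ ≤ K ∧ v ∈ dom := ⟨hK, hv⟩
      simp only [dif_pos hKv, levelGauge_same]
      have e : δ K = CO * θ ^ K := by simp only [hδ, if_pos hK]
      have hm := hmaj K
      rw [e] at hm
      exact ((hfu K v hK hv).2.2.2.2).trans hm
    · have hKv : ¬ (K₀ ≤ K ∧ v ∈ dom) := fun h' => hK h'.1
      simp only [dif_neg hKv]
      have e : δ K = levelGauge L N (K, (1 : Site 4 → Fin 4 → (Matrix n n ℂ)ˣ))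
          (K, rescale L (bavg L (1 : Site 4 → Fin 4 → (Matrix n n ℂ)ˣ))) := by simp only [hδ, if_neg hK]
      rw [← e]
      exact hmaj K

/-! ## §2 The same on the OCCURRING classes (no class binder left) -/

/-- **`hclose` ON THE CARRIER OF THE OCCURRING CLASSES** `NE7EtaBackgroundCarrier.occCarriers`: as `hclose_of_covRootH`, with the five class
binders discharged by construction (`one_mem_occA`, `one_mem_occB`, `rescale_bavg_mem_occA`, `minimiser_mem_occA`, `minimiser_mem_occB`) — the
only remaining data are `dom`, the class constant `ε`, the root∕class∕budget constants and the abstract domain catalogue. [folklore] -/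
theorem hclose_of_covRootH_occ {L N : ℕ} (hL : 2 ≤ L) (hN : 1 ≤ N) {θ : ℝ} (hθ : 0 < θ)
    (hθ18 : θ ^ 18 = ((L : ℝ))⁻¹) {ε : ℝ} (hε : 0 ≤ ε) (hls : ∀ j : ℕ, LevelSmall 4 L j (ε / ((L : ℝ) ^ (j + 1)) ^ 2))
    {b g C Λ₁ ΛH : ℝ} (hb : 0 ≤ b) (hbs : 512 * (4 + 1) * (4 + 4) * (L : ℝ) ^ 2 * b ≤ 1) (hg : 0 ≤ g) (hC : 0 ≤ C)
    (hΛH : 0 ≤ ΛH) {dom : Set (Site 4 → Fin 4 → (Matrix n n ℂ)ˣ)}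
    (hdom : ∀ v ∈ dom, ∀ w : Site 4 → (Matrix n n ℂ)ˣ, IsUnitarySite w → IsPeriodicSite w (N : ℤ) → gaugeAct w v ∈ dom)
    (h : ∀ k : ℕ, 1 ≤ k → ∀ V ∈ dom, ∀ UA UB : Site 4 → Fin 4 → (Matrix n n ℂ)ˣ,
      IsMinimiser 4 (sfClass 4 L N ε) L N k V UA → IsMinimiser 4 (sfClass 4 L N ε) L N (k + 1) V UB →
        Regular 4 L N b g (k + 1) UB →
        ∃ (u : Site 4 → (Matrix n n ℂ)ˣ) (Z : Site 4 → Fin 4 → Matrix n n ℂ),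
          IsUnitarySite u ∧ IsPeriodicSite u ((N * L ^ k : ℕ) : ℤ) ∧
          IsSkewDir Z ∧ IsPeriodicDir Z ((N * L ^ k : ℕ) : ℤ) ∧
          gaugeAct u UA = vary (rescale L (bavg L UB)) Z 1 ∧
          energyNormW L k (rescale L (bavg L UB)) Z (periodBox (N * L ^ k)) ≤ C * residualScale 4 L N b g k ∧
          (∀ (κ : Fin 4) (x : Site 4) (μ : Fin 4),
            ‖Ad (rescale L (bavg L UB) (x + e κ) μ) (Z (x + e μ) κ) - Z x κ‖ ≤ Λ₁ * (((L : ℝ)⁻¹) ^ k) ^ 2) ∧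
          (∀ (κ μ : Fin 4) (y : Site 4) (j : ℕ),
            ‖Ad (((List.range j).map fun i : ℕ => rescale L (bavg L UB) (y + e κ + i • e μ) μ).prod)
                  (Ad (rescale L (bavg L UB) (y + j • e μ + e κ) μ) (Z (y + j • e μ + e μ) κ) - Z (y + j • e μ) κ)
                - (Ad (rescale L (bavg L UB) (y + e κ) μ) (Z (y + e μ) κ) - Z y κ)‖
              ≤ ΛH * Real.sqrt (j : ℝ) * (((L : ℝ)⁻¹) ^ k) ^ 2 * Real.sqrt (((L : ℝ)⁻¹) ^ k)))
    {γ l₁ : ℝ} (hγ : 0 < γ)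
    (hγ3 : C * (wallConst 4 L * (N : ℝ) ^ 2 * (Real.sqrt g * dualC2 4 L + 2 * b ^ 2 * dualC1 4 L)) ≤ γ ^ 3)
    (hl₁ : 0 < l₁) (hΛl₁ : Λ₁ ≤ l₁ ^ 3)
    (hexA : ∀ K : ℕ, 1 ≤ K → ∀ v ∈ dom, ∃ UA : Site 4 → Fin 4 → (Matrix n n ℂ)ˣ, IsMinimiser 4 (sfClass 4 L N ε) L N K v UA)
    {σB c₀ : ℝ} (hσB : 0 ≤ σB) (hsector : (Fintype.card n : ℝ) * (N : ℝ) ^ 2 * ε ≤ c₀)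
    (hexB : ∀ K : ℕ, 1 ≤ K → ∀ v ∈ dom, (Fintype.card n : ℝ) * (N : ℝ) ^ 2 * ε ≤ c₀ →
      ∃ UB : Site 4 → Fin 4 → (Matrix n n ℂ)ˣ, IsMinimiser 4 (sfClass 4 L N ε) L N (K + 1) v UB ∧ Regular 4 L N b g (K + 1) UB ∧
        ∃ uB : Site 4 → (Matrix n n ℂ)ˣ, IsUnitarySite uB ∧ IsPeriodicSite uB ((N * L ^ (K + 1) : ℕ) : ℤ) ∧
          ∃ AB : Site 4 → Fin 4 → Matrix n n ℂ, ∀ (x : Site 4) (κ : Fin 4),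
            ((gaugeAct uB UB x κ : (Matrix n n ℂ)ˣ) : Matrix n n ℂ) = exp (AB x κ) ∧ ‖AB x κ‖ ≤ σB * θ ^ (18 * (K + 1)))
    (D : Type) (sc : D → ℕ) (dl : D → ℝ) (hdl : ∀ X, 0 ≤ dl X) :
    ∃ (uA : ℕ → (Site 4 → Fin 4 → (Matrix n n ℂ)ˣ) → (occCarriers n L N ε dom D sc dl hdl).BgA)
      (uB : ℕ → (Site 4 → Fin 4 → (Matrix n n ℂ)ˣ) → (occCarriers n L N ε dom D sc dl hdl).BgB) (K₀ : ℕ) (C₃ : ℝ),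
      0 ≤ C₃ ∧
      (∀ K : ℕ, K₀ ≤ K → ∀ v ∈ dom, ∃ (UA UB : Site 4 → Fin 4 → (Matrix n n ℂ)ˣ) (wA wB : Site 4 → (Matrix n n ℂ)ˣ),
        IsMinimiser 4 (sfClass 4 L N ε) L N K v UA ∧ IsMinimiser 4 (sfClass 4 L N ε) L N (K + 1) v UB ∧
        Regular 4 L N b g (K + 1) UB ∧ IsUnitarySite wA ∧ IsPeriodicSite wA ((N * L ^ K : ℕ) : ℤ) ∧
        IsUnitarySite wB ∧ IsPeriodicSite wB ((N * L ^ (K + 1) : ℕ) : ℤ) ∧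
        (uA K v).1 = (K, gaugeAct wA UA) ∧ (uB K v).1 = (K, gaugeAct wB UB)) ∧
      (∀ (K : ℕ) (v : Site 4 → Fin 4 → (Matrix n n ℂ)ˣ), ¬ (K₀ ≤ K ∧ v ∈ dom) →
        (uA K v).1 = (K, 1) ∧ (uB K v).1 = (K, 1)) ∧
      ∀ K : ℕ, ∀ v ∈ dom, (occCarriers n L N ε dom D sc dl hdl).gauge (uA K v)
          ((occCarriers n L N ε dom D sc dl hdl).transport (uB K v))
        ≤ C₃ * θ ^ K :=
  hclose_of_covRootH hL hN hθ hθ18 hε hls hb hbs hg hC hΛH hdom h hγ hγ3 hl₁ hΛl₁ hexA hσB hsector hexB D sc dl hdl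
    (rescale_bavg_mem_occA L N ε dom) (one_mem_occA L N ε dom) (one_mem_occB L N ε dom) (minimiser_mem_occA L N ε dom)
    (minimiser_mem_occB L N ε dom)


end

end Summit.QuantumFields.BalabanUV.T4Continuum.NE7EtaBackgroundClosenessHolder
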